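import Literature.AlgebraicGeometry.Resolution.QuadraticTransformsKeyLemma
import HarnessLib

/-!
# `𝔪_R T` is principal for a dominating two-dimensional regular local ring `T ⊋ R`

Topic: `Literature/AlgebraicGeometry/Resolution`. Row F79-F1-i of the sub-cell «(1.2) 2-reg» of the D-0154 (2)
RES inputs cell: the ring-level corollary of the key lemma of quadratic transforms
(`QuadraticTransformsKeyLemma.exists_rsop_div_mem_of_ne`; Huneke–Swanson, Thm. 14.5.2, "the crucial point";
Abhyankar 1956): for `R ⊊ T` two-dimensional regular local rings of a field `K = Frac R` with `T` dominating
`R`, the extended ideal `𝔪_R T` is principal, generated by a non-zero `x ∈ R` — i.e. `𝔪_R 𝒪` is invertible at a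
closed point of a birational regular model, the local content of Zariski's factorisation of a resolution through
the blowing up of the closed point (skeleton `F79_2reg_BRICKS_SKELETON.lean`, `stub_factor`). No definitions, no
named facts.

## Sources

* C. Huneke, I. Swanson, *Integral Closure of Ideals, Rings, and Modules*, CUP 2006, Thm. 14.5.2 and its proof
  (pp. 276–277). [HunekeSwanson2006]
* S. Abhyankar, Amer. J. Math. 78 (1956), Thm. 3. [Abhyankar1956Valuations]
-/

noncomputable section

namespace Literature.AlgebraicGeometry.Resolution

universe u

open IsLocalRing

/-- **`𝔪_R T = x T` (Huneke–Swanson 14.5.2, "the crucial point").** Let `R ⊊ T` be two-dimensional regular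
local rings of `K = Frac R`, `T` dominating `R`. Then for a suitable non-zero `x ∈ R` (part of a regular system
of parameters `𝔪_R = (x, y)` with `y/x ∈ T`) the extension of `𝔪_R` to `T` is the principal ideal `x T`.
[cite: HunekeSwanson2006, Thm. 14.5.2 (proof, "the crucial point")] -/
theorem exists_map_maximalIdeal_eq_span_singleton_of_ne {K : Type u} [Field K] {R T : Subring K}
    (hR : IsRegularLocalRing R) (hRdim : ringKrullDim R = 2) (hRK : IsLocalRingOf R)
    (hT : IsRegularLocalRing T) (hTdim : ringKrullDim T = 2) (hdom : SubringDominates R T)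
    (hne : R ≠ T) :
    ∃ x : R, x ≠ 0 ∧
      (maximalIdeal R).map (Subring.inclusion hdom.1) = Ideal.span {Subring.inclusion hdom.1 x} := by
  obtain ⟨x, y, hm, hx0, -, hyx⟩ := exists_rsop_div_mem_of_ne hR hRdim hRK hT hTdim hdom hne
  refine ⟨x, hx0, ?_⟩
  set ι := Subring.inclusion hdom.1 with hι
  have hxK : ((x : R) : K) ≠ 0 := fun h => hx0 (Subtype.ext h)
  -- `ι y = ι x · (y/x)` in `T`
  have hy : ι y = ι x * ⟨((y : R) : K) / ((x : R) : K), hyx⟩ := by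
    apply Subtype.ext
    change ((y : R) : K) = ((x : R) : K) * (((y : R) : K) / ((x : R) : K))
    rw [mul_div_cancel₀ _ hxK]
  rw [hm, Ideal.map_span, Set.image_pair]
  apply le_antisymm
  · rw [Ideal.span_le]
    rintro z hz
    rcases hz with rfl | rfl
    · exact Ideal.subset_span rfl
    · change ι y ∈ Ideal.span {ι x}
      rw [hy]
      exact Ideal.mul_mem_right _ _ (Ideal.subset_span rfl)
  · exact Ideal.span_mono (Set.singleton_subset_iff.mpr (Set.mem_insert _ _))

end Literature.AlgebraicGeometry.Resolution

end
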